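/-
Copyright (c) 2026 the pub-hodgecm-mathlib formalisation cell (harness21).  Prover seat hodgecm-mathlib-F0P3a-p01 (g23), 2026-09-03.  E1 row 39γ (generic half): geodesic
sequences in a tree — the graph-theoretic input of «every geodesic segment of the `U(3)` tree lies in an apartment translate» (E1 keeper ∕ dealer F0P3a-p03 (g29) 01:32:15Z).
-/
import Literature.Combinatorics.SimpleGraph.TreeDescendantPartition   -- ★ `TreeLayers.exists_rooted_parent` (parent map of a rooted tree: the «child is one step farther» clause)
import HarnessLib

/-!
# Geodesic sequences in a tree: an injective sequence of consecutive neighbours realises the distance and carries every geodesic between its points (Serre, *Trees* I.2.2)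

Topic `Combinatorics/SimpleGraph`; namespace `Literature.Combinatorics.SimpleGraph.SequencePath`.  THEOREMS ONLY (no definition, no instance, no notation, no named fact,
no `sorry`); Mathlib + ★ `TreeDescendantPartition`.  Cell `pub/hodgecm-mathlib` (D-0151), crux H413 = `stmt-HodgeConjecture-24833`; E1 row 39γ, generic half (consumed by
★-to-be `NumberTheory/Automorphic/UnitaryLatticeTreeGeodesicApartment`: the enumerated apartment `j ↦ A j` of the `U(3)` tree is such a sequence).  HONEST LABEL: count-neutral
generic base layer; HC_CM is proved only modulo the 2 remaining named inputs (hLiu418 24832, h413 24833) until rung 0 closes; nothing printed is asserted here.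

THE MATHEMATICS.  `G` a simple graph, `f : ℤ → V` with `f j ~ f (j+1)` for all `j` and `f` injective (a «straight» bi-infinite sequence).  Then `f i, f (i+1), …, f (i+n)` is a
PATH of length `n` (§1).  If `G` is a TREE, paths are unique and realise the distance, so `dist (f i) (f k) = |k − i|` and every vertex `w` on a geodesic between `f i` and
`f k` (`dist (f i) w + dist w (f k) = dist (f i) (f k)`) is some `f j` with `j` between `i` and `k` (§2).  §3 is the «outward neighbour» remark: of two distinct neighbours of a
vertex `z`, at least one is one step FARTHER from a given `x` than `z` (at most one neighbour is the parent towards `x`, ★ `exists_rooted_parent`).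
(The orbit version `j ↦ τ^j v₀` of §1–§2 is ★ `TreeAction.exists_path_pow_smul` ∕ `adj_zpow_smul_iff`; here the sequence is arbitrary, e.g. of period two under a translation.)

* §1 `exists_path_of_adj_succ`; §2 **`dist_eq_of_adj_succ`**, `dist_eq_natAbs`, **`exists_eq_of_dist_add_dist_eq`**; §3 `exists_dist_eq_succ_of_adj_of_adj`.

## References
* [Serre1980Trees] J.-P. Serre, *Trees* (1980), Ch. I §2.2 Prop. 8 (in a tree two vertices are joined by exactly one path, the geodesic), Ch. I §6.4 (straight paths).
* [Diestel2010] R. Diestel, *Graph Theory*, 4th ed. (2010), Thm. 1.5.1 (equivalent characterisations of trees: unique paths).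
-/

set_option autoImplicit false

/-! ## §1 The path along the sequence -/

namespace Literature.Combinatorics.SimpleGraph.SequencePath

open _root_.SimpleGraph

variable {V : Type*} {G : SimpleGraph V}

/-- **The walk `f i, f (i+1), …, f (i+n)` is a PATH of length `n`** with support `{f j | i ≤ j ≤ i + n}`, for `f : ℤ → V` injective with consecutive values adjacent.
[cite: Serre1980Trees, I.2.2] [cite: Diestel2010, Thm. 1.5.1] -/
theorem exists_path_of_adj_succ (f : ℤ → V) (hadj : ∀ j : ℤ, G.Adj (f j) (f (j + 1))) (hinj : Function.Injective f) (i : ℤ) (n : ℕ) :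
    ∃ p : G.Walk (f i) (f (i + n)), p.IsPath ∧ p.length = n ∧ ∀ u ∈ p.support, ∃ j : ℤ, i ≤ j ∧ j ≤ i + n ∧ u = f j := by
  induction n generalizing i with
  | zero =>
    refine ⟨(Walk.nil : G.Walk (f i) (f i)).copy rfl (by simp), by simp, by simp, fun u hu => ⟨i, le_rfl, by simp, ?_⟩⟩
    simpa using hu
  | succ n ih =>
    obtain ⟨p, hp, hlen, hsupp⟩ := ih (i + 1)
    have e : f (i + 1 + (n : ℤ)) = f (i + ((n + 1 : ℕ) : ℤ)) := by congr 1; push_cast; ring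
    have hnot : f i ∉ (p.copy rfl e).support := by
      intro h
      rw [Walk.support_copy] at h
      obtain ⟨j, hj1, -, hj3⟩ := hsupp _ h
      have := hinj hj3
      omega
    refine ⟨Walk.cons (hadj i) (p.copy rfl e), (Walk.cons_isPath_iff (hadj i) (p.copy rfl e)).2 ⟨by simpa using hp, hnot⟩,
      by simp [hlen], fun u hu => ?_⟩
    rw [Walk.support_cons, List.mem_cons] at hu
    rcases hu with rfl | hu
    · exact ⟨i, le_rfl, by omega, rfl⟩
    · rw [Walk.support_copy] at hu
      obtain ⟨j, hj1, hj2, rfl⟩ := hsupp u hu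
      exact ⟨j, by omega, by push_cast; omega, rfl⟩

/-! ## §2 In a tree: distance and betweenness along the sequence -/

/-- **In a tree, `dist (f i) (f (i+n)) = n`** (the path of `exists_path_of_adj_succ` is THE path, and a path realises the distance). [cite: Serre1980Trees, I.2.2 Prop. 8]
[cite: Diestel2010, Thm. 1.5.1] -/
theorem dist_eq_of_adj_succ (hT : G.IsTree) (f : ℤ → V) (hadj : ∀ j : ℤ, G.Adj (f j) (f (j + 1))) (hinj : Function.Injective f) (i : ℤ) (n : ℕ) :
    G.dist (f i) (f (i + n)) = n := by
  obtain ⟨p, hp, hlen, -⟩ := exists_path_of_adj_succ f hadj hinj i n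
  obtain ⟨q, hq, hql⟩ := hT.1.exists_path_of_dist (f i) (f (i + n))
  have hqp : q = p := (hT.existsUnique_path (f i) (f (i + n))).unique hq hp
  rw [← hql, hqp, hlen]

/-- **In a tree, `dist (f i) (f k) = |k − i|`.** [cite: Serre1980Trees, I.2.2 Prop. 8] [cite: Diestel2010, Thm. 1.5.1] -/
theorem dist_eq_natAbs (hT : G.IsTree) (f : ℤ → V) (hadj : ∀ j : ℤ, G.Adj (f j) (f (j + 1))) (hinj : Function.Injective f) (i k : ℤ) :
    G.dist (f i) (f k) = (k - i).natAbs := by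
  rcases le_total i k with hik | hki
  · have hk : k = i + ((k - i).natAbs : ℤ) := by omega
    conv_lhs => rw [hk]
    exact dist_eq_of_adj_succ hT f hadj hinj i _
  · have hi : i = k + ((k - i).natAbs : ℤ) := by omega
    rw [SimpleGraph.dist_comm]
    conv_lhs => rw [hi]
    exact dist_eq_of_adj_succ hT f hadj hinj k _

/-- **In a tree, every vertex on a geodesic between `f i` and `f k` (`i ≤ k`) is some `f j`, `i ≤ j ≤ k`**: concatenating geodesics `f i ⇝ w ⇝ f k` of total length
`dist (f i) (f k)` gives a path, which is THE path `f i, …, f k`. [cite: Serre1980Trees, I.2.2 Prop. 8] [cite: Diestel2010, Thm. 1.5.1] -/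
theorem exists_eq_of_dist_add_dist_eq (hT : G.IsTree) (f : ℤ → V) (hadj : ∀ j : ℤ, G.Adj (f j) (f (j + 1))) (hinj : Function.Injective f)
    {i k : ℤ} (hik : i ≤ k) {w : V} (hw : G.dist (f i) w + G.dist w (f k) = G.dist (f i) (f k)) :
    ∃ j : ℤ, i ≤ j ∧ j ≤ k ∧ w = f j := by
  obtain ⟨n, hn⟩ : ∃ n : ℕ, k = i + n := ⟨(k - i).toNat, by omega⟩
  subst hn
  obtain ⟨p, hp, hlen, hsupp⟩ := exists_path_of_adj_succ f hadj hinj i n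
  obtain ⟨p₁, hp₁, hl₁⟩ := hT.1.exists_path_of_dist (f i) w
  obtain ⟨p₂, hp₂, hl₂⟩ := hT.1.exists_path_of_dist w (f (i + n))
  have hW : (p₁.append p₂).IsPath := by
    apply Walk.isPath_of_length_eq_dist
    rw [Walk.length_append, hl₁, hl₂, hw]
  have hWp : p₁.append p₂ = p := (hT.existsUnique_path (f i) (f (i + n))).unique hW hp
  have hmem : w ∈ p.support := by
    rw [← hWp, Walk.mem_support_append_iff]
    exact Or.inl (Walk.end_mem_support p₁)
  exact hsupp w hmem

/-! ## §3 The outward neighbour -/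

/-- **The outward neighbour**: in a tree, if `z` has two distinct neighbours `c₀ ≠ c₁`, then for every vertex `x` at least one of them is FARTHER from `x` than `z`
(`dist x c = dist x z + 1`), i.e. `z` lies on the geodesic `[x, c]` (at most one neighbour of `z` is its parent towards `x`). [cite: Serre1980Trees, I.2.2 Prop. 8] -/
theorem exists_dist_eq_succ_of_adj_of_adj (hT : G.IsTree) (x : V) {z c₀ c₁ : V} (h₀ : G.Adj z c₀) (h₁ : G.Adj z c₁) (hne : c₀ ≠ c₁) :
    G.dist x c₀ = G.dist x z + 1 ∨ G.dist x c₁ = G.dist x z + 1 := by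
  obtain ⟨p, -, hchild, -, -⟩ := TreeLayers.exists_rooted_parent hT x
  by_cases hz : z = x
  · subst hz
    left
    rw [SimpleGraph.dist_self, SimpleGraph.dist_eq_one_iff_adj]
    exact h₀
  · by_cases hc : c₀ = p z
    · right
      have hc1 : c₁ ≠ p z := fun h => hne (hc.trans h.symm)
      exact (hchild z c₁ hz h₁ hc1).1
    · left
      exact (hchild z c₀ hz h₀ hc).1

end Literature.Combinatorics.SimpleGraph.SequencePath

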